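import Summits.BirchSwinnertonDyer.BirchSwinnertonDyer.Theorems.GoldfeldAllTwistsTwoConverseTwinBirchLemmaKrizLi7
import HarnessLib

set_option linter.dupNamespace false -- namespace `…BirchSwinnertonDyer.BirchSwinnertonDyer…` is the cell's (D-0017 nested layout)
set_option autoImplicit false

/-!
# LINE B49, file 4b — the `ℚ`-level consumers of Kriz–Li Thm. 1.20 at `p = 7` for `X₀(49)`: «Conjecture D(q)»
# (`ord_{s=1} L(49a1^{(−q)}, s) = 1`) on the `7`-adic-unit sub-family, the certified members `q = 5, 13, 17`,
# K12₂″'s conclusion and the structure of the family there, and twin″ = `ord₂ 𝔮₄₉ = 0` with NO `r_an` hypothesis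

Cell `bsd-goldfeld`, seat `bsd-goldfeld-s1p-c301` (prover, gen 5), TARGET v5.1 §2 c301 (e) T2–T4 (planner g12 memo
`LINE-B49-PRESEARCH.md` §4). `--supports` the S1⁺ route items stmt-BirchSwinnertonDyer-19140 (twin″
`…Theses.GoldfeldAllTwistsTwoConverse.BSDTwoCMSevenAdditiveRankOne`) and 20044 (K12₂″ `…RankOneTwoConverseCMSevenAdditiveTwo`).
Companion of file 4 (`…TwinBirchLemmaKrizLi7`: T1 `not_isOfFinAddOrder_heegnerPoint_cm7_of_thm120` — every level-`49`
Heegner point of `X₀(49)` over `K`, `d_K = −4q`, has infinite order when `q` is a prime with `(q/7) = −1` whose Bernoulli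
certificate `7 ∤ B_{1,ε_{−4q}ω⁴}` holds, granted `KrizLi2019.thm120_padicLogHeegner_unit_of_bernoulli`). HONEST FRAMING:
RANK axis at `p = 7` only; both items are OPEN and nothing here proves either; the prime family `{49a1^{(−q)}}` has
twist-density ZERO (a WITNESS family / rung, never a closer — planner ruling TARGET §3 (iv)); nothing is claimed at the
non-unit `q` (`97, 157, 409, 509, …`); BSD is not proved by any of this.

## Contents (THEOREMS ONLY; no `def`, no instance, no named fact; published inputs = the cell's cite-tagged binders BY NAME:
## KL19 Thm. 1.20 `h120`, Modularity `hnf`, Coates–Li–Tian–Zhai Thm. 1.2 at `R = 1` `h12`, Gross–Zagier `hGZ`, Kolyvagin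
## `hKo`, GZK `hGZK`, Heegner rationality `hHP`, Burungale–Flach 2024 `hBF`)

* §1 `analyticRankEK_cm7_eq_one_of_heegner_nonTorsion` (Gross–Zagier dictionary at level `49`),
  `analyticRankEK_cm7_eq_one_of_thm120` (**T2 over `K`**: `ord_{s=1} L(X₀(49)/K, s) = 1` for `d_K = −4q`, `q` a unit prime),
  `analyticRank_twist_discr_eq_one_of_thm120` (the same for the models `Cd • X₀(49)^{(d_K)}` over a GIVEN Heegner field,
  without `hHP`).
* §2 **T2** `analyticRank_eq_one_inertPrimeTwist_of_thm120{,'}` — «Conjecture D(q)»: `ord_{s=1} L(W, s) = 1` for EVERY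
  elliptic `W/ℚ` isomorphic to `49a1^{(−q)}`, every unit prime `q ≡ 1 (mod 4)`, `(q/7) = −1` (= seat c301 gen 4's
  `analyticRank_eq_one_inertPrimeTwist_of_birch` with clause (i) of B49 DISCHARGED by T1);
  `rankOneTwoConverse_inertPrimeTwist_of_thm120` (K12₂″'s conclusion outright), `structure_inertPrimeTwist_of_thm120`
  (`r_an = 1`, `rank = 1`, `Ш[2^∞] = 0`, `corank₂ = 1`, twin″ ⟺ `#Ш_an ∈ ℤ₂^×` — seat c301 gen 2's complete `2`-descent).
* §3 **T3** the certified members: `analyticRank_eq_one_twist_cm7_neg5 / _neg13 / _neg17` (bsd-cm's kernel certificates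
  `RouteU.norm_generalizedBernoulli_theta1_E20 / _E52 / _E68`), and the cross-cell link
  `analyticRank_eq_one_twist_cm7_negFourMul_E20_E52_E68`: the hypothesis `hr1 : r_an(W) = 1` of bsd-cm's even-member
  theorems `RouteU.bsdp_seven_of_twist_cm7_E20 / _E52 / _E68` (models of `49a1^{(−20)}, 49a1^{(−52)}, 49a1^{(−68)}`) is
  DISCHARGED from the same five named facts.
* §4 **T4** `bsdp_two_iff_x049Quotient_unit_inertPrimeTwist_of_thm120` — on the unit sub-family the item twin″ is
  LITERALLY `ord₂ 𝔮₄₉ = 0` (`𝔮₄₉ = x049HeegnerTwistQuotient`, file 1 of the line) at THE halvability value `k`, with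
  NO analytic-rank hypothesis (seat c301 gen 4's `bsdp_two_iff_x049Quotient_unit_inertPrimeTwist`, its `r_an(W) = 1`
  discharged by §1); instance `bsdp_two_iff_x049Quotient_unit_twist_cm7_neg5` (`K = ℚ(√−5)`, no certificate binder).

NOT touched: clause (ii) of B49 (KL19 at `7` cannot see `2`-divisibility), the ∀-statements K12₂″ / twin″ (no `7`-adic
distribution theorem in the twist family is in print), the `90` non-unit `q < 20000`.
References: [KrizLi2019] Thm. 1.20, Rem. 1.21; [GrossZagier1986] I.(6.3), V.§2; [Gross1991] (1.1); [CoatesLiTianZhai2015]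
Thm. 1.2, 1.4; [BurungaleFlach2024] Thm. 1.1, Cor. 2; [Miller2011LMS] Def. 1.1; [BurungaleCastellaSkinnerTian2022] Rem. D;
[SilvermanAEC2009] X.4–X.5; [Washington1997] §5.1.
-/

noncomputable section

open scoped Classical NumberTheorySymbols

open WeierstrassCurve NumberField DirichletCharacter
open Literature.NumberTheory Literature.NumberTheory.EllipticCurves
  Literature.NumberTheory.EllipticCurves.ModularForms
open Literature.NumberTheory.EllipticCurves.KrizLi2019 Literature.NumberTheory.LFunctions
open Summit.BirchSwinnertonDyer.Rank1Residual
open Summit.BirchSwinnertonDyer.Rank1Residual.X12.O11.RouteU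

namespace Summit.BirchSwinnertonDyer.BirchSwinnertonDyer.Theorems.GoldfeldGoodTwists

/-! ## §1 The Gross–Zagier dictionary at level `49`: Heegner non-torsion ⟹ `ord_{s=1} L(X₀(49)/K, s) = 1` -/

/-- **`ord_{s=1} L(X₀(49)/K, s) = 1` from the non-torsion of the level-`49` Heegner points**, for `K` imaginary
quadratic satisfying the Heegner hypothesis for `49`, granted Modularity (`hnf`, the sign), Gross–Zagier (`hGZ`) and
the `K`-rationality of Heegner points (`hHP`): a Heegner point exists and the dictionary
`analyticRankEK_eq_one_iff_heegner_nonTorsion_of_exists_isNewformOf` (`N(X₀(49)) = 49`) converts.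
[cite: GrossZagier1986, Thm. I.(6.3) with V.§2 and I.§7] [cite: Gross1991, (1.1)] -/
theorem analyticRankEK_cm7_eq_one_of_heegner_nonTorsion (hnf : ModularForms.exists_isNewformOf)
    (hGZ : ∀ (N : ℕ) [NeZero N] (W : WeierstrassCurve ℚ) (K : Type) [Field K] [NumberField K],
      gross_zagier N W K)
    (hHP : ∀ (W : WeierstrassCurve ℚ) (K : Type) [Field K] [NumberField K], exists_isHeegnerPoint W K)
    (K : Type) [Field K] [NumberField K] (hK : IsImaginaryQuadratic K) (hH : SatisfiesHeegnerHypothesis 49 K)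
    (hnt : ∀ P : (cm7.baseChange K).toAffine.Point, IsHeegnerPoint 49 cm7 K P → ¬ IsOfFinAddOrder P) :
    analyticRankEK cm7 K = 1 := by
  haveI : NeZero (cm7.conductorNorm ℤ) := ⟨(cm7.conductorNorm_pos_holds).ne'⟩
  have hH' : SatisfiesHeegnerHypothesis (cm7.conductorNorm ℤ) K := by rw [conductorNorm_cm7]; exact hH
  obtain ⟨P, hP0⟩ := hHP cm7 K hK hH'
  have hP : IsHeegnerPoint 49 cm7 K P := isHeegnerPoint_of_level_eq conductorNorm_cm7 hP0
  exact (analyticRankEK_eq_one_iff_heegner_nonTorsion_of_exists_isNewformOf cm7 49 K (hGZ 49 cm7 K) hnf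
    hK conductorNorm_cm7 hH hP).mpr (hnt P hP)

/-- **T2 over `K`: KL19 Thm. 1.20 ∧ certificate(q) ⟹ `ord_{s=1} L(X₀(49)/K, s) = 1` for every imaginary quadratic
`K` with `d_K = −4q`** (`q` prime, `(q/7) = −1`; `7` splits in `K` by `jacobiSym_neg_prime_seven`), granted
Modularity, Gross–Zagier and Heegner rationality — file 4's T1 through §1.
[cite: KrizLi2019, Thm. 1.20 (pp. 7–8) and Rem. 1.21] [cite: GrossZagier1986, Thm. I.(6.3)] -/
theorem analyticRankEK_cm7_eq_one_of_thm120 (h120 : thm120_padicLogHeegner_unit_of_bernoulli) (hnf : ModularForms.exists_isNewformOf)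
    (hGZ : ∀ (N : ℕ) [NeZero N] (W : WeierstrassCurve ℚ) (K : Type) [Field K] [NumberField K],
      gross_zagier N W K)
    (hHP : ∀ (W : WeierstrassCurve ℚ) (K : Type) [Field K] [NumberField K], exists_isHeegnerPoint W K)
    {q : ℕ} [Fact q.Prime] (hq7 : jacobiSym q 7 = -1)
    (hcert : ∀ (ω : DirichletCharacter ℚ_[7] 7), IsTeichmullerCharacter ω →
      ∀ θ : DirichletCharacter ℚ_[7] (7 * (4 * q)),
        (∀ j : ZMod (7 * (4 * q)), θ j =
          ((if Even j.val then (0 : ℤ) else J(-(q : ℤ) | j.val) : ℤ) : ℚ_[7]) * ω (j.val : ZMod 7) ^ 4) →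
        ‖generalizedBernoulli 1 θ‖ = 1)
    (K : Type) [Field K] [NumberField K] (hK : IsImaginaryQuadratic K)
    (hdK : NumberField.discr K = -(4 * (q : ℤ))) : analyticRankEK cm7 K = 1 :=
  analyticRankEK_cm7_eq_one_of_heegner_nonTorsion hnf hGZ hHP K hK
    (satisfiesHeegnerHypothesis_fortyNine_of_discr_eq K hK.1 (by rw [hdK]; ring) (jacobiSym_neg_prime_seven hq7))
    (fun _ hP => not_isOfFinAddOrder_heegnerPoint_cm7_of_thm120 h120 hq7 hcert K hK hdK hP)

/-- **T2 over a GIVEN Heegner field, no `hHP`: `ord_{s=1} L(W, s) = 1` for every elliptic `W = Cd • X₀(49)^{(d_K)}`**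
(`d_K = −4q`; the models of `49a1^{(−q)}`), from a Heegner point `P ∈ X₀(49)(K)` in hand: T1 puts `P` off the torsion,
Gross–Zagier gives `ord L(X₀(49)/K) = 1`, Artin formalism `ord L(X₀(49)/K) = ord L(X₀(49)) + ord L(X₀(49)^{(d_K)})` with
`ord L(X₀(49)) = 0` (Coates–Li–Tian–Zhai Thm. 1.2 at `R = 1`, `h12`; `analyticRankEK_cm7`) and isogeny invariance.
[cite: KrizLi2019, Thm. 1.20 (pp. 7–8)] [cite: CoatesLiTianZhai2015, Thm. 1.2 (p. 359, case r = 0)]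
[cite: GrossZagier1986, Thm. I.(6.3) and I.§7] -/
theorem analyticRank_twist_discr_eq_one_of_thm120 (h120 : thm120_padicLogHeegner_unit_of_bernoulli)
    (hnf : ModularForms.exists_isNewformOf) (h12 : CoatesLiTianZhai2015.thm12_fullBSD_twist)
    (hGZ : ∀ (N : ℕ) [NeZero N] (W : WeierstrassCurve ℚ) (K : Type) [Field K] [NumberField K],
      gross_zagier N W K)
    {q : ℕ} [Fact q.Prime] (hq7 : jacobiSym q 7 = -1)
    (hcert : ∀ (ω : DirichletCharacter ℚ_[7] 7), IsTeichmullerCharacter ω →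
      ∀ θ : DirichletCharacter ℚ_[7] (7 * (4 * q)),
        (∀ j : ZMod (7 * (4 * q)), θ j =
          ((if Even j.val then (0 : ℤ) else J(-(q : ℤ) | j.val) : ℤ) : ℚ_[7]) * ω (j.val : ZMod 7) ^ 4) →
        ‖generalizedBernoulli 1 θ‖ = 1)
    (K : Type) [Field K] [NumberField K] (hK : IsImaginaryQuadratic K)
    (hdK : NumberField.discr K = -(4 * (q : ℤ)))
    {P : (cm7.baseChange K).toAffine.Point} (hP : IsHeegnerPoint 49 cm7 K P)
    (W : WeierstrassCurve ℚ) [W.IsElliptic] (Cd : VariableChange ℚ)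
    (hW : Cd • cm7.quadraticTwist (NumberField.discr K : ℚ) = W) : W.analyticRank = 1 := by
  haveI : NeZero (cm7.conductorNorm ℤ) := ⟨(cm7.conductorNorm_pos_holds).ne'⟩
  have hmod : hasEntireLFunction_rat := hasEntireLFunction_rat_of_exists_isNewformOf hnf
  have hH : SatisfiesHeegnerHypothesis 49 K :=
    satisfiesHeegnerHypothesis_fortyNine_of_discr_eq K hK.1 (by rw [hdK]; ring) (jacobiSym_neg_prime_seven hq7)
  have hEK := (analyticRankEK_eq_one_iff_heegner_nonTorsion_of_exists_isNewformOf cm7 49 K (hGZ 49 cm7 K) hnf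
    hK conductorNorm_cm7 hH hP).mpr (not_isOfFinAddOrder_heegnerPoint_cm7_of_thm120 h120 hq7 hcert K hK hdK hP)
  have hd : (NumberField.discr K : ℚ) ≠ 0 := by exact_mod_cast NumberField.discr_ne_zero K
  haveI := cm7.isElliptic_quadraticTwist hd
  have hiso : IsIsogenous W (cm7.quadraticTwist (NumberField.discr K : ℚ)) := isIsogenous_of_smul_eq' hW
  rw [analyticRankEK_cm7 hmod h12 K, ← analyticRank_eq_of_isIsogenous' hiso] at hEK
  exact hEK

/-! ## §2 T2 over `ℚ` — «Conjecture D(q)» on the `7`-adic-unit sub-family -/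

/-- **T2 («CONJECTURE D(q)» for the unit `q`): `ord_{s=1} L(W, s) = 1` for EVERY elliptic `W/ℚ` that is
`ℚ`-isomorphic to `X₀(49)^{(−q)} = 49a1^{(−q)}`, for every prime `q ≡ 1 (mod 4)` with `(q/7) = −1` whose Bernoulli
certificate holds** (`7 ∤ B_{1,ε_{−4q}ω⁴}`; `482/572` of the `q < 20000`), granted KL19 Thm. 1.20 (`h120`),
Modularity (`hnf`), Coates–Li–Tian–Zhai Thm. 1.2 at `R = 1` (`h12`), Gross–Zagier (`hGZ`) and Heegner rationality
(`hHP`). Seat c301 gen 4's `analyticRank_eq_one_inertPrimeTwist_of_birch` with clause (i) of B49 DISCHARGED by T1: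
`K = ℚ(√−q)` exists (`d_K = −4q`), §1 gives `ord L(X₀(49)/K) = 1`, Artin formalism and `X₀(49)^{(−4q)} ≅ X₀(49)^{(−q)} ≅ W`.
An infinite decidable family of rank-one `L`-values on the ADDITIVE-at-`2` cell, no Selmer hypothesis.
[cite: KrizLi2019, Thm. 1.20 (pp. 7–8) and Rem. 1.21] [cite: CoatesLiTianZhai2015, Thm. 1.2 (p. 359, case r = 0)]
[cite: GrossZagier1986, Thm. I.(6.3) and I.§7] -/
theorem analyticRank_eq_one_inertPrimeTwist_of_thm120 (h120 : thm120_padicLogHeegner_unit_of_bernoulli)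
    (hnf : ModularForms.exists_isNewformOf) (h12 : CoatesLiTianZhai2015.thm12_fullBSD_twist)
    (hGZ : ∀ (N : ℕ) [NeZero N] (W : WeierstrassCurve ℚ) (K : Type) [Field K] [NumberField K],
      gross_zagier N W K)
    (hHP : ∀ (W : WeierstrassCurve ℚ) (K : Type) [Field K] [NumberField K], exists_isHeegnerPoint W K)
    {q : ℕ} [Fact q.Prime] (hq4 : q % 4 = 1) (hq7 : jacobiSym q 7 = -1)
    (hcert : ∀ (ω : DirichletCharacter ℚ_[7] 7), IsTeichmullerCharacter ω →
      ∀ θ : DirichletCharacter ℚ_[7] (7 * (4 * q)),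
        (∀ j : ZMod (7 * (4 * q)), θ j =
          ((if Even j.val then (0 : ℤ) else J(-(q : ℤ) | j.val) : ℤ) : ℚ_[7]) * ω (j.val : ZMod 7) ^ 4) →
        ‖generalizedBernoulli 1 θ‖ = 1)
    (W : WeierstrassCurve ℚ) [W.IsElliptic] (C : VariableChange ℚ)
    (hC : C • W = cm7.quadraticTwist ((-q : ℤ) : ℚ)) : W.analyticRank = 1 := by
  have hq : q.Prime := Fact.out
  have hmod : hasEntireLFunction_rat := hasEntireLFunction_rat_of_exists_isNewformOf hnf
  have hsq : Squarefree (-(q : ℤ)) := by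
    rw [← Int.squarefree_natAbs, Int.natAbs_neg, Int.natAbs_natCast]
    exact hq.squarefree
  have hq0 : ((-q : ℤ) : ℚ) ≠ 0 := by
    have := hq.pos
    exact_mod_cast (show (-(q : ℤ)) ≠ 0 by omega)
  haveI := cm7.isElliptic_quadraticTwist hq0
  -- `K = ℚ(√−q)`, `d_K = −4q`
  obtain ⟨K, _, _, h2, hdK⟩ := QuadraticFields.Quadratic.exists_numberField_discr_eq (D := 4 * (-(q : ℤ)))
    (Or.inr ⟨dvd_mul_right 4 _, by rw [show 4 * (-(q : ℤ)) / 4 = -(q : ℤ) by omega]; omega,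
      by rw [show 4 * (-(q : ℤ)) / 4 = -(q : ℤ) by omega]; exact hsq⟩)
  have hK : IsImaginaryQuadratic K :=
    isImaginaryQuadratic_iff_discr_neg.mpr ⟨h2, by rw [hdK]; have := hq.pos; omega⟩
  have hEK := analyticRankEK_cm7_eq_one_of_thm120 h120 hnf hGZ hHP hq7 hcert K hK (by rw [hdK]; ring)
  -- `X₀(49)^{(d_K)} = X₀(49)^{(4·(−q))} ≅ X₀(49)^{(−q)} ≅ W`
  have htw : cm7.quadraticTwist (NumberField.discr K : ℚ) =
      (⟨(Units.mk0 (2 : ℚ) two_ne_zero)⁻¹, 0, 0, 0⟩ : VariableChange ℚ) • cm7.quadraticTwist ((-q : ℤ) : ℚ) := by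
    rw [hdK, show ((-q : ℤ) : ℚ) = ((-(q : ℤ) : ℤ) : ℚ) by push_cast; ring]
    exact quadraticTwist_cm7_four_mul (-(q : ℤ))
  haveI : (cm7.quadraticTwist (NumberField.discr K : ℚ)).IsElliptic := by rw [htw]; infer_instance
  have hWdK : IsIsogenous W (cm7.quadraticTwist (NumberField.discr K : ℚ)) := by
    rw [htw]
    exact (isIsogenous_of_smul_eq hC).trans' (isIsogenous_smul _ _)
  rw [analyticRankEK_cm7 hmod h12 K, ← analyticRank_eq_of_isIsogenous' hWdK] at hEK
  exact hEK

/-- The same with `q` inert in `ℚ(√−7)` written `(−7/q) = −1` (seat c301 gen 2's convention). [cite: KrizLi2019, Thm. 1.20 (pp. 7–8)] -/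
theorem analyticRank_eq_one_inertPrimeTwist_of_thm120' (h120 : thm120_padicLogHeegner_unit_of_bernoulli)
    (hnf : ModularForms.exists_isNewformOf) (h12 : CoatesLiTianZhai2015.thm12_fullBSD_twist)
    (hGZ : ∀ (N : ℕ) [NeZero N] (W : WeierstrassCurve ℚ) (K : Type) [Field K] [NumberField K],
      gross_zagier N W K)
    (hHP : ∀ (W : WeierstrassCurve ℚ) (K : Type) [Field K] [NumberField K], exists_isHeegnerPoint W K)
    {q : ℕ} [Fact q.Prime] (hq4 : q % 4 = 1) (hq7 : legendreSym q (-7) = -1)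
    (hcert : ∀ (ω : DirichletCharacter ℚ_[7] 7), IsTeichmullerCharacter ω →
      ∀ θ : DirichletCharacter ℚ_[7] (7 * (4 * q)),
        (∀ j : ZMod (7 * (4 * q)), θ j =
          ((if Even j.val then (0 : ℤ) else J(-(q : ℤ) | j.val) : ℤ) : ℚ_[7]) * ω (j.val : ZMod 7) ^ 4) →
        ‖generalizedBernoulli 1 θ‖ = 1)
    (W : WeierstrassCurve ℚ) [W.IsElliptic] (C : VariableChange ℚ)
    (hC : C • W = cm7.quadraticTwist ((-q : ℤ) : ℚ)) : W.analyticRank = 1 :=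
  analyticRank_eq_one_inertPrimeTwist_of_thm120 h120 hnf h12 hGZ hHP hq4
    (by rw [jacobiSym_seven_eq_legendreSym_neg_seven hq4, hq7]) hcert W C hC

/-- **K12₂″ ON THE UNIT SUB-FAMILY** — the implication of the route decl `RankOneTwoConverseCMSevenAdditiveTwo` (item
20044), `corank_{ℤ₂} Sel_{2^∞}(W) = 1 ⟹ ord_{s=1} L(W, s) = 1`, for every model `W` of `49a1^{(−q)}` with `q` a unit
prime: its CONCLUSION holds outright (T2). [cite: KrizLi2019, Thm. 1.20 (pp. 7–8)] [cite: BurungaleCastellaSkinnerTian2022, Rem. D (p. 327)] -/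
theorem rankOneTwoConverse_inertPrimeTwist_of_thm120 (h120 : thm120_padicLogHeegner_unit_of_bernoulli)
    (hnf : ModularForms.exists_isNewformOf) (h12 : CoatesLiTianZhai2015.thm12_fullBSD_twist)
    (hGZ : ∀ (N : ℕ) [NeZero N] (W : WeierstrassCurve ℚ) (K : Type) [Field K] [NumberField K],
      gross_zagier N W K)
    (hHP : ∀ (W : WeierstrassCurve ℚ) (K : Type) [Field K] [NumberField K], exists_isHeegnerPoint W K)
    {q : ℕ} [Fact q.Prime] (hq4 : q % 4 = 1) (hq7 : legendreSym q (-7) = -1)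
    (hcert : ∀ (ω : DirichletCharacter ℚ_[7] 7), IsTeichmullerCharacter ω →
      ∀ θ : DirichletCharacter ℚ_[7] (7 * (4 * q)),
        (∀ j : ZMod (7 * (4 * q)), θ j =
          ((if Even j.val then (0 : ℤ) else J(-(q : ℤ) | j.val) : ℤ) : ℚ_[7]) * ω (j.val : ZMod 7) ^ 4) →
        ‖generalizedBernoulli 1 θ‖ = 1)
    (W : WeierstrassCurve ℚ) [W.IsElliptic] (C : VariableChange ℚ)
    (hC : C • W = cm7.quadraticTwist ((-q : ℤ) : ℚ)) :
    W.selmerCorank 2 = 1 → W.analyticRank = 1 :=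
  fun _ => analyticRank_eq_one_inertPrimeTwist_of_thm120' h120 hnf h12 hGZ hHP hq4 hq7 hcert W C hC

/-- **THE STRUCTURE OF THE UNIT SUB-FAMILY**, granted moreover GZK over `ℚ` (`hGZK`): for every unit prime
`q ≡ 1 (mod 4)` inert in `ℚ(√−7)` and every model `W` of `49a1^{(−q)}`: `ord_{s=1} L(W,s) = 1` (T2), `rank W(ℚ) = 1`,
`Ш(W/ℚ)[2^∞] = 0`, `corank_{ℤ₂} Sel_{2^∞}(W) = 1`, and twin″(`W`) = `BSD(W,2)` ⟺ `#Ш_an(W)` is a `2`-adic unit (seat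
c301 gen 2's complete `2`-descent `bsdp_two_iff_shaAn_unit_primeTwist`, its analytic-rank hypothesis DISCHARGED).
[cite: KrizLi2019, Thm. 1.20 (pp. 7–8)] [cite: SilvermanAEC2009, Thm. X.4.2(a), Prop. X.4.9] [cite: Miller2011LMS, Def. 1.1] -/
theorem structure_inertPrimeTwist_of_thm120 (h120 : thm120_padicLogHeegner_unit_of_bernoulli)
    (hnf : ModularForms.exists_isNewformOf) (h12 : CoatesLiTianZhai2015.thm12_fullBSD_twist)
    (hGZ : ∀ (N : ℕ) [NeZero N] (W : WeierstrassCurve ℚ) (K : Type) [Field K] [NumberField K],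
      gross_zagier N W K)
    (hHP : ∀ (W : WeierstrassCurve ℚ) (K : Type) [Field K] [NumberField K], exists_isHeegnerPoint W K)
    (hGZK : rank_eq_analyticRank_of_analyticRank_le_one)
    {q : ℕ} [Fact q.Prime] (hq4 : q % 4 = 1) (hq7 : legendreSym q (-7) = -1)
    (hcert : ∀ (ω : DirichletCharacter ℚ_[7] 7), IsTeichmullerCharacter ω →
      ∀ θ : DirichletCharacter ℚ_[7] (7 * (4 * q)),
        (∀ j : ZMod (7 * (4 * q)), θ j =
          ((if Even j.val then (0 : ℤ) else J(-(q : ℤ) | j.val) : ℤ) : ℚ_[7]) * ω (j.val : ZMod 7) ^ 4) →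
        ‖generalizedBernoulli 1 θ‖ = 1)
    (W : WeierstrassCurve ℚ) [W.IsElliptic] (C : VariableChange ℚ)
    (hC : C • W = cm7.quadraticTwist ((-q : ℤ) : ℚ)) :
    W.analyticRank = 1 ∧ W.mordellWeilRank = 1 ∧ AddCommGroup.primaryComponent W.sha 2 = ⊥ ∧
      W.selmerCorank 2 = 1 ∧ (BSDp W 2 ↔ ∃ r : ℚ, shaAn W = (r : ℂ) ∧ padicValRat 2 r = 0) := by
  have har := analyticRank_eq_one_inertPrimeTwist_of_thm120' h120 hnf h12 hGZ hHP hq4 hq7 hcert W C hC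
  exact ⟨har, bsdp_two_iff_shaAn_unit_primeTwist hGZK hq4 hq7 W C hC har⟩

/-! ## §3 T3 over `ℚ` — the certified members: `ord_{s=1} L(W, s) = 1` for every model of `49a1^{(−5)}`,
`49a1^{(−13)}`, `49a1^{(−17)}` (and of `49a1^{(−20)}, 49a1^{(−52)}, 49a1^{(−68)}`), UNCONDITIONAL in the certificate -/

/-- A model of `X₀(49)^{(−4q)}` is a model of `X₀(49)^{(−q)}`. [cite: SilvermanAEC2009, X.5 Prop. 5.4] -/
theorem exists_smul_eq_twist_neg_of_smul_eq_twist_neg_four_mul {q : ℕ} (W : WeierstrassCurve ℚ)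
    (C : VariableChange ℚ) (hC : C • W = cm7.quadraticTwist ((-(4 * (q : ℤ)) : ℤ) : ℚ)) :
    ∃ C' : VariableChange ℚ, C' • W = cm7.quadraticTwist ((-q : ℤ) : ℚ) := by
  have htw : cm7.quadraticTwist ((-(4 * (q : ℤ)) : ℤ) : ℚ) =
      (⟨(Units.mk0 (2 : ℚ) two_ne_zero)⁻¹, 0, 0, 0⟩ : VariableChange ℚ) • cm7.quadraticTwist ((-q : ℤ) : ℚ) := by
    rw [show ((-q : ℤ) : ℚ) = ((-(q : ℤ) : ℤ) : ℚ) by push_cast; ring,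
      show ((-(4 * (q : ℤ)) : ℤ) : ℚ) = ((4 * (-(q : ℤ)) : ℤ) : ℚ) by push_cast; ring]
    exact quadraticTwist_cm7_four_mul (-(q : ℤ))
  refine ⟨(⟨(Units.mk0 (2 : ℚ) two_ne_zero)⁻¹, 0, 0, 0⟩ : VariableChange ℚ)⁻¹ * C, ?_⟩
  rw [← smul_smul, hC, htw, smul_smul, inv_mul_cancel, one_smul]

/-- **T3, `q = 5`: `ord_{s=1} L(W, s) = 1` for EVERY elliptic `W/ℚ` isomorphic to `49a1^{(−5)}`** (conductor
`784·25 = 19600`), granted KL19 Thm. 1.20, Modularity, CLTZ Thm. 1.2 (`R = 1`), Gross–Zagier, Heegner rationality — the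
Bernoulli certificate is bsd-cm's kernel theorem `RouteU.norm_generalizedBernoulli_theta1_E20`; `(5/7) = −1`.
[cite: KrizLi2019, Thm. 1.20 (pp. 7–8) and Rem. 1.21] [cite: Washington1997, §5.1 and Thm. 4.2] -/
theorem analyticRank_eq_one_twist_cm7_neg5 (h120 : thm120_padicLogHeegner_unit_of_bernoulli)
    (hnf : ModularForms.exists_isNewformOf) (h12 : CoatesLiTianZhai2015.thm12_fullBSD_twist)
    (hGZ : ∀ (N : ℕ) [NeZero N] (W : WeierstrassCurve ℚ) (K : Type) [Field K] [NumberField K],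
      gross_zagier N W K)
    (hHP : ∀ (W : WeierstrassCurve ℚ) (K : Type) [Field K] [NumberField K], exists_isHeegnerPoint W K)
    (W : WeierstrassCurve ℚ) [W.IsElliptic] (C : VariableChange ℚ) (hC : C • W = cm7.quadraticTwist (-5)) :
    W.analyticRank = 1 :=
  haveI : Fact (Nat.Prime 5) := ⟨by norm_num⟩
  analyticRank_eq_one_inertPrimeTwist_of_thm120 h120 hnf h12 hGZ hHP (q := 5) (by norm_num) (by norm_num)
    norm_generalizedBernoulli_theta1_E20 W C (by rw [hC]; norm_num)

/-- **T3, `q = 13`: `ord_{s=1} L(W, s) = 1` for every elliptic `W/ℚ` isomorphic to `49a1^{(−13)}`** (certificate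
`RouteU.norm_generalizedBernoulli_theta1_E52`; `(13/7) = −1`). [cite: KrizLi2019, Thm. 1.20 (pp. 7–8) and Rem. 1.21]
[cite: Washington1997, §5.1 and Thm. 4.2] -/
theorem analyticRank_eq_one_twist_cm7_neg13 (h120 : thm120_padicLogHeegner_unit_of_bernoulli)
    (hnf : ModularForms.exists_isNewformOf) (h12 : CoatesLiTianZhai2015.thm12_fullBSD_twist)
    (hGZ : ∀ (N : ℕ) [NeZero N] (W : WeierstrassCurve ℚ) (K : Type) [Field K] [NumberField K],
      gross_zagier N W K)
    (hHP : ∀ (W : WeierstrassCurve ℚ) (K : Type) [Field K] [NumberField K], exists_isHeegnerPoint W K)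
    (W : WeierstrassCurve ℚ) [W.IsElliptic] (C : VariableChange ℚ) (hC : C • W = cm7.quadraticTwist (-13)) :
    W.analyticRank = 1 :=
  haveI : Fact (Nat.Prime 13) := ⟨by norm_num⟩
  analyticRank_eq_one_inertPrimeTwist_of_thm120 h120 hnf h12 hGZ hHP (q := 13) (by norm_num) (by norm_num)
    norm_generalizedBernoulli_theta1_E52 W C (by rw [hC]; norm_num)

/-- **T3, `q = 17`: `ord_{s=1} L(W, s) = 1` for every elliptic `W/ℚ` isomorphic to `49a1^{(−17)}`** (certificate
`RouteU.norm_generalizedBernoulli_theta1_E68`; `(17/7) = −1`). [cite: KrizLi2019, Thm. 1.20 (pp. 7–8) and Rem. 1.21]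
[cite: Washington1997, §5.1 and Thm. 4.2] -/
theorem analyticRank_eq_one_twist_cm7_neg17 (h120 : thm120_padicLogHeegner_unit_of_bernoulli)
    (hnf : ModularForms.exists_isNewformOf) (h12 : CoatesLiTianZhai2015.thm12_fullBSD_twist)
    (hGZ : ∀ (N : ℕ) [NeZero N] (W : WeierstrassCurve ℚ) (K : Type) [Field K] [NumberField K],
      gross_zagier N W K)
    (hHP : ∀ (W : WeierstrassCurve ℚ) (K : Type) [Field K] [NumberField K], exists_isHeegnerPoint W K)
    (W : WeierstrassCurve ℚ) [W.IsElliptic] (C : VariableChange ℚ) (hC : C • W = cm7.quadraticTwist (-17)) :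
    W.analyticRank = 1 :=
  haveI : Fact (Nat.Prime 17) := ⟨by norm_num⟩
  analyticRank_eq_one_inertPrimeTwist_of_thm120 h120 hnf h12 hGZ hHP (q := 17) (by norm_num) (by norm_num)
    norm_generalizedBernoulli_theta1_E68 W C (by rw [hC]; norm_num)

/-- **Cross-cell link (bsd-cm ROUTE U, even members `E20 / E52 / E68`): the hypothesis `hr1 : r_an(W) = 1` of
`RouteU.bsdp_seven_of_twist_cm7_E20 / _E52 / _E68` is DISCHARGED** — every elliptic `W/ℚ` with
`C • W = X₀(49)^{(−4n)}`, `n ∈ {5, 13, 17}`, has `ord_{s=1} L(W, s) = 1` (granted the same five named facts).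
[cite: KrizLi2019, Thm. 1.20 (pp. 7–8) and Rem. 1.21] -/
theorem analyticRank_eq_one_twist_cm7_negFourMul_E20_E52_E68 (h120 : thm120_padicLogHeegner_unit_of_bernoulli)
    (hnf : ModularForms.exists_isNewformOf) (h12 : CoatesLiTianZhai2015.thm12_fullBSD_twist)
    (hGZ : ∀ (N : ℕ) [NeZero N] (W : WeierstrassCurve ℚ) (K : Type) [Field K] [NumberField K],
      gross_zagier N W K)
    (hHP : ∀ (W : WeierstrassCurve ℚ) (K : Type) [Field K] [NumberField K], exists_isHeegnerPoint W K)
    {n : ℕ} (hn : n = 5 ∨ n = 13 ∨ n = 17) (W : WeierstrassCurve ℚ) [W.IsElliptic]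
    (hW : ∃ C : VariableChange ℚ, C • W = cm7.quadraticTwist ((-(4 * (n : ℤ)) : ℤ) : ℚ)) :
    W.analyticRank = 1 := by
  obtain ⟨C, hC⟩ := hW
  obtain ⟨C', hC'⟩ := exists_smul_eq_twist_neg_of_smul_eq_twist_neg_four_mul W C hC
  rcases hn with rfl | rfl | rfl
  · exact analyticRank_eq_one_twist_cm7_neg5 h120 hnf h12 hGZ hHP W C' (by rw [hC']; norm_num)
  · exact analyticRank_eq_one_twist_cm7_neg13 h120 hnf h12 hGZ hHP W C' (by rw [hC']; norm_num)
  · exact analyticRank_eq_one_twist_cm7_neg17 h120 hnf h12 hGZ hHP W C' (by rw [hC']; norm_num)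

/-! ## §4 T4 — twin″ on the unit sub-family is EXACTLY `ord₂ 𝔮₄₉ = 0`, with NO analytic-rank hypothesis -/

/-- **T4. On the unit sub-family the item twin″ (`BSD(W, 2)`) is LITERALLY the `2`-adic unit statement
`ord₂ 𝔮₄₉ = 0` — no `r_an(W) = 1` hypothesis left.** For `q` a unit prime (`q ≡ 1 (mod 4)`, `(−7/q) = −1`, Bernoulli
certificate), `K` imaginary quadratic with `d_K = −4q`, a level-`49` Heegner datum `(Dt, H, ι)` with point `P ∈ X₀(49)(K)`
and every globally minimal `W = Cd • X₀(49)^{(d_K)}` (a minimal model of `49a1^{(−q)}`): there is THE halvability value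
`k ∈ {1, 2}` with `BSD(W, 2) ⟺ ord₂ (x049HeegnerTwistQuotient K P Dt.c k W Cd.u) = 0` — seat c301 gen 4's
`bsdp_two_iff_x049Quotient_unit_inertPrimeTwist` (file 2b of the line: the role-swapped exact Gross–Zagier index identity
`#Ш_an(W) = 𝔮₄₉` + the complete `2`-descent), whose hypothesis `r_an(W) = 1` is DISCHARGED by T2 over the given `K`
(§1, no `hHP`). Granted KL19 Thm. 1.20, Modularity, CLTZ Thm. 1.2 (`R = 1`), Burungale–Flach 2024, Gross–Zagier,
Kolyvagin, GZK. [cite: KrizLi2019, Thm. 1.20 (pp. 7–8)] [cite: Miller2011LMS, Def. 1.1]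
[cite: GrossZagier1986, Thm. I.(6.3) and V.§2] [cite: BurungaleFlach2024, Thm. 1.1 and Cor. 2 (p. 4)] -/
theorem bsdp_two_iff_x049Quotient_unit_inertPrimeTwist_of_thm120
    (h120 : thm120_padicLogHeegner_unit_of_bernoulli) (hnf : ModularForms.exists_isNewformOf)
    (h12 : CoatesLiTianZhai2015.thm12_fullBSD_twist) (hBF : bsdTriple_of_hasCM_of_L_one_ne_zero)
    (hGZ : ∀ (N : ℕ) [NeZero N] (W : WeierstrassCurve ℚ) (K : Type) [Field K] [NumberField K],
      gross_zagier N W K)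
    (hKo : ∀ (N : ℕ) [NeZero N] (W : WeierstrassCurve ℚ) (K : Type) [Field K] [NumberField K],
      kolyvagin N W K)
    (hGZK : rank_eq_analyticRank_of_analyticRank_le_one)
    {q : ℕ} [Fact q.Prime] (hq4 : q % 4 = 1) (hq7 : legendreSym q (-7) = -1)
    (hcert : ∀ (ω : DirichletCharacter ℚ_[7] 7), IsTeichmullerCharacter ω →
      ∀ θ : DirichletCharacter ℚ_[7] (7 * (4 * q)),
        (∀ j : ZMod (7 * (4 * q)), θ j =
          ((if Even j.val then (0 : ℤ) else J(-(q : ℤ) | j.val) : ℤ) : ℚ_[7]) * ω (j.val : ZMod 7) ^ 4) →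
        ‖generalizedBernoulli 1 θ‖ = 1)
    (K : Type) [Field K] [NumberField K] (hK : IsImaginaryQuadratic K) (hdK : NumberField.discr K = -(4 * (q : ℤ)))
    (Dt : ModularParametrizationData cm7 49) (H : HeegnerDatum 49 (NumberField.discr K)) (ι : K →+* ℂ)
    (P : (cm7.baseChange K).toAffine.Point)
    (hP : WeierstrassCurve.Affine.Point.map ι.toRatAlgHom P = heegnerPointComplex Dt H)
    (W : WeierstrassCurve ℚ) [W.IsElliptic] [W.IsGloballyMinimal] (Cd : VariableChange ℚ)
    (hW : Cd • cm7.quadraticTwist (NumberField.discr K : ℚ) = W) :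
    ∃ k : ℕ, (k = 1 ∨ k = 2) ∧
      (k = 2 ↔ ∀ y : W.toAffine.Point, ∃ Q : (W.baseChange K).toAffine.Point,
        QuadraticDescent.incl K W y - (2 : ℤ) • Q ∈ AddCommGroup.torsion (W.baseChange K).toAffine.Point) ∧
      (BSDp W 2 ↔ padicValRat 2 (x049HeegnerTwistQuotient K P Dt.c k W Cd.u) = 0) := by
  have hqj : jacobiSym q 7 = -1 := by rw [jacobiSym_seven_eq_legendreSym_neg_seven hq4, hq7]
  have har : W.analyticRank = 1 :=
    analyticRank_twist_discr_eq_one_of_thm120 h120 hnf h12 hGZ hqj hcert K hK hdK ⟨Dt, H, ι, hP⟩ W Cd hW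
  exact bsdp_two_iff_x049Quotient_unit_inertPrimeTwist hnf h12 hBF hGZ hKo hGZK hq4 hq7 K hK hdK Dt H ι P hP W Cd
    hW har

/-- **T4 for the certified member `q = 5`** (`K = ℚ(√−5)`, minimal models of `49a1^{(−5)}`): twin″(`W`) ⟺
`ord₂ 𝔮₄₉ = 0`, NO analytic-rank hypothesis and NO certificate hypothesis. [cite: KrizLi2019, Thm. 1.20 (pp. 7–8)]
[cite: Miller2011LMS, Def. 1.1] [cite: GrossZagier1986, Thm. I.(6.3) and V.§2] -/
theorem bsdp_two_iff_x049Quotient_unit_twist_cm7_neg5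
    (h120 : thm120_padicLogHeegner_unit_of_bernoulli) (hnf : ModularForms.exists_isNewformOf)
    (h12 : CoatesLiTianZhai2015.thm12_fullBSD_twist) (hBF : bsdTriple_of_hasCM_of_L_one_ne_zero)
    (hGZ : ∀ (N : ℕ) [NeZero N] (W : WeierstrassCurve ℚ) (K : Type) [Field K] [NumberField K],
      gross_zagier N W K)
    (hKo : ∀ (N : ℕ) [NeZero N] (W : WeierstrassCurve ℚ) (K : Type) [Field K] [NumberField K],
      kolyvagin N W K)
    (hGZK : rank_eq_analyticRank_of_analyticRank_le_one)
    (K : Type) [Field K] [NumberField K] (hK : IsImaginaryQuadratic K) (hdK : NumberField.discr K = -20)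
    (Dt : ModularParametrizationData cm7 49) (H : HeegnerDatum 49 (NumberField.discr K)) (ι : K →+* ℂ)
    (P : (cm7.baseChange K).toAffine.Point)
    (hP : WeierstrassCurve.Affine.Point.map ι.toRatAlgHom P = heegnerPointComplex Dt H)
    (W : WeierstrassCurve ℚ) [W.IsElliptic] [W.IsGloballyMinimal] (Cd : VariableChange ℚ)
    (hW : Cd • cm7.quadraticTwist (NumberField.discr K : ℚ) = W) :
    ∃ k : ℕ, (k = 1 ∨ k = 2) ∧
      (k = 2 ↔ ∀ y : W.toAffine.Point, ∃ Q : (W.baseChange K).toAffine.Point,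
        QuadraticDescent.incl K W y - (2 : ℤ) • Q ∈ AddCommGroup.torsion (W.baseChange K).toAffine.Point) ∧
      (BSDp W 2 ↔ padicValRat 2 (x049HeegnerTwistQuotient K P Dt.c k W Cd.u) = 0) :=
  haveI : Fact (Nat.Prime 5) := ⟨by norm_num⟩
  bsdp_two_iff_x049Quotient_unit_inertPrimeTwist_of_thm120 h120 hnf h12 hBF hGZ hKo hGZK (q := 5) (by norm_num)
    (by norm_num) norm_generalizedBernoulli_theta1_E20 K hK
    (by rw [hdK]; norm_num) Dt H ι P hP W Cd hW

end Summit.BirchSwinnertonDyer.BirchSwinnertonDyer.Theorems.GoldfeldGoodTwists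

end
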